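import Summits.ValiantsHypothesis.ValiantsHypothesis.Theorems.KPlusLogSqLawTropicalCycleMonotone
import Summits.ValiantsHypothesis.ValiantsHypothesis.Theorems.LacunarySymmetroidMatrixDescartesCensusTropicalKLawSlopes
import Summits.ValiantsHypothesis.ValiantsHypothesis.Theorems.LacunarySymmetroidMatrixDescartesCensusTropicalKLawStatic

/-!
# Route «KPlusLogSqLaw», crux `TropicalB` (stmt-ValiantsHypothesis-19771) — three exchange laws for EQUALLY SPACED dominant chains:
# the TRANSFER LAW (4-term exchange ⇒ entanglement), the UNIT-STEP LAW (slope gap 1 ⇒ single exchange cycle), CONVEX VALUATIONS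

HONEST FRAMING.  Helper file toward the registered stubs `stub_tropThin` / `stub_tropFat` of `Cruxes/TropicalB/Lines/birth.lean`
(crux `Summit.ValiantsHypothesis.ValiantsHypothesis.Theses.KPlusLogSqLaw.TropicalB`, item stmt-ValiantsHypothesis-19771, route
KPlusLogSqLaw; cell `pub-symmetroid`, seat val-sym-trop-p5 g17, refuter-adjacent lane, 2026-08-28; `--supports … --as helper`).
STRUCTURAL laws on dominance designs valid at every format `(m, K)` (no hypothesis on exponents, valuations or support); they bound
nothing for `TropicalB` in its window and bear on neither `WeakLifting`, DoorA26 / DoorA34, `MatrixDescartes` (stmt-ValiantsHypothesis-18050)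
nor VP ≠ VNP.  Vocabulary: `IsDominant`, `tropWeight`, `termSign` (…MatrixDescartesFalseOfTropicalMonster), `TropicalCensus.slope`
(…CensusTropicalKLawSlopes), the invariant-set exchange of `…TropicalCycleMonotone`.

WHY (the radix-2 rung of the crux's construction side = MARKED-EDGE binary counters, val-sym-trop-p4 g14/g15 `…MarkedEdgeCounter`,
`…MarkedEdgeFourThree`: `2^K` dominant terms on `m` nodes whose marked-loop sets run through all subsets in binary order; `m_min(2)=3`,
`m_min(3)=5`, `m_min(4) ≥ 7`).  In such a chain the slopes are CONSECUTIVE INTEGERS, and the four terms with indices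
`w, w+2^u, w+2^v, w+2^u+2^v` (`u < v`, bits `u, v` of `w` clear) form a «parallelogram» of slopes.  This file proves, for arbitrary designs:

* §1 **TRANSFER LAW** (`TransferLaw.no_transfer`): let `p_a, p_b, p_c, p_e` be dominant at `θ_a, θ_b ≤ θ_c, θ_e` and let `C` be a
  column set invariant under the quotient `σ_b⁻¹ σ_c`.  If exchanging `C` between `p_b` and `p_c` would move `p_b` to the slope of
  `p_a` and `p_c` to the slope of `p_e`, and `slope p_a < slope p_b`, this is IMPOSSIBLE (sum of the four dominance inequalities against
  the exchanged terms and against `p_a`, `p_e`: the valuations cancel and `(slope p_b − slope p_a)·(θ_c − θ_b) < 0` remains).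
  Corollary `TransferLaw.sameCycle_of_columns` — ENTANGLEMENT: if `p_b, p_c` carry the same exponent in every column except `u, v` and the
  exponent surplus of `p_b` over `p_c` at column `u` equals `slope p_b − slope p_a = slope p_e − slope p_c > 0`, then the columns `u` and
  `v` lie on ONE cycle of `σ_b⁻¹ σ_c`.  (Binary counters: for every context `w` and bits `u < v` the optimal covers of the patterns
  `w+2^u` and `w+2^v` are entangled — the marked loop of `u` and the marked loop of `v` sit on a common alternating cycle; val-sym-trop-p4
  g14's paper rule «E0» for ALL contexts, now kernel.)
* §2 **UNIT-STEP LAW** (`UnitStep.not_split`, `UnitStep.sameCycle`, `UnitStep.eq_of_apply_eq`): two dominant terms (earlier, later) whose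
  slopes differ by at most `1` differ on NO pair of complementary invariant column sets; hence all columns where they differ lie on one cycle
  of the quotient, and a class change at a column fixed by the quotient is their only difference.  (Binary counters: consecutive covers differ
  by exactly one alternating cycle, which threads the marked loops of bits `0, …, j` at the step `t → t+1`, `j` = lowest clear bit of `t`.)
* §3 **CONVEX VALUATIONS** (`EqualSteps.valuation_step_lt`): if `p₁` is dominant and `p₀ ≠ p₁`, `p₂` are present terms with
  `slope p₁ − slope p₀ = slope p₂ − slope p₁`, then `V p₁ − V p₀ < V p₂ − V p₁` (`V` = valuation sum `∑ i, v (σ i) i (λ i)`); so along a dominant chain with equally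
  spaced slopes the valuation sums are strictly convex in the index — for a binary counter the pattern cost is strictly convex in the binary
  value and (equal-width chords) strictly SUPERMODULAR on the OFF-lattice, the necessary condition behind §1.
READING (located architecture census of this seat, memo HOME/val-sym-trop-p5/g17/COUNTER-MECHANISMS-g17.md): the three laws kill, uniformly in
`K`, nearest-neighbour / load-level / separator-decomposable counter architectures and explain the exact LP deaths of the tour, orphan-hub,
skip and domino-wire architectures at `K = 3`.  [folklore: LP duality / exchange arguments for the assignment polytope; the 4-fold case of
`TropicalCensus.sum_mul_slope_lt_of_redecomp` (…TropicalExchange), proved here directly]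
-/

set_option linter.dupNamespace false
set_option autoImplicit false

namespace Summit.ValiantsHypothesis.ValiantsHypothesis.Theorems.KPlusLogSqLaw

open Summit.ValiantsHypothesis.ValiantsHypothesis.Theorems.MatrixDescartes.Negative
open Summit.ValiantsHypothesis.ValiantsHypothesis.Theorems.LacunarySymmetroidMatrixDescartes (TropicalCensus.slope
  TropicalCensus.present_of_termSign_ne_zero)
open scoped BigOperators

/-! ## §1 The transfer law (four-term exchange) and entanglement -/

namespace TransferLaw

variable {m K : ℕ}

/-- `tropWeight = θ·slope − (valuation sum)`. [folklore] -/
theorem tropWeight_eq (d : Fin K → ℕ) (v : Fin m → Fin m → Fin K → ℤ) (θ : ℤ) (p : Equiv.Perm (Fin m) × (Fin m → Fin K)) :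
    tropWeight d v θ p = θ * TropicalCensus.slope d p - ∑ i, v (p.1 i) i (p.2 i) := rfl

/-- **TRANSFER LAW (four-term exchange).**  `p_a, p_b, p_c, p_e` dominant at `θ_a, θ_b, θ_c, θ_e` with `θ_b ≤ θ_c` and
`slope p_a < slope p_b`; `C` a column set invariant under `σ_b⁻¹ σ_c`.  If the exponent mass that `p_b` carries on `C` in excess of
`p_c` equals both `slope p_b − slope p_a` and `slope p_e − slope p_c` — so that exchanging `C` between `p_b` and `p_c` produces present
terms at the slopes of `p_a` and of `p_e` — we reach a contradiction: adding the dominance of `p_a` over the first exchanged term, of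
`p_e` over the second, of `p_b` over `p_a` and of `p_c` over `p_e`, all valuations cancel and `(slope p_b − slope p_a)(θ_c − θ_b) < 0`
is left. [folklore: exchange argument; 4-fold case of the re-decomposition lemma] -/
theorem no_transfer (d : Fin K → ℕ) (v ε : Fin m → Fin m → Fin K → ℤ) {θa θb θc θe : ℤ} (hbc : θb ≤ θc)
    {pa pb pc pe : Equiv.Perm (Fin m) × (Fin m → Fin K)}
    (ha : IsDominant d v ε θa pa) (hb : IsDominant d v ε θb pb) (hc : IsDominant d v ε θc pc) (he : IsDominant d v ε θe pe)
    (hab : TropicalCensus.slope d pa < TropicalCensus.slope d pb) (C : Finset (Fin m)) (hC : ∀ i, (pb.1⁻¹ * pc.1) i ∈ C ↔ i ∈ C)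
    (hCa : ∑ i ∈ C, (d (pb.2 i) : ℤ) - ∑ i ∈ C, (d (pc.2 i) : ℤ) = TropicalCensus.slope d pb - TropicalCensus.slope d pa)
    (hCe : ∑ i ∈ C, (d (pb.2 i) : ℤ) - ∑ i ∈ C, (d (pc.2 i) : ℤ) = TropicalCensus.slope d pe - TropicalCensus.slope d pc) : False := by
  classical
  obtain ⟨σb, lb⟩ := pb
  obtain ⟨σc, lc⟩ := pc
  dsimp only at hC hCa hCe
  obtain ⟨πC, hπC, hπC', hπCmem⟩ := exists_perm_restrict (σb⁻¹ * σc) C hC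
  -- the exchanged terms: `rb` = `pb` with the `C`-part of `pc`, `rc` = `pc` with the `C`-part of `pb`
  set rb : Equiv.Perm (Fin m) × (Fin m → Fin K) := (σb * πC, fun i => if i ∈ C then lc i else lb i) with hrb
  set rc : Equiv.Perm (Fin m) × (Fin m → Fin K) := (σc * πC⁻¹, fun i => if i ∈ C then lb i else lc i) with hrc
  have rb1_in : ∀ i ∈ C, rb.1 i = σc i := by
    intro i hi; show σb (πC i) = σc i; rw [hπC i hi]; simp
  have rb1_out : ∀ i ∉ C, rb.1 i = σb i := by
    intro i hi; show σb (πC i) = σb i; rw [hπC' i hi]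
  have rc1_in : ∀ i ∈ C, rc.1 i = σb i := by
    intro i hi
    show σc (πC⁻¹ i) = σb i
    have hci : πC⁻¹ i ∈ C := (hπCmem (πC⁻¹ i)).1 (by simpa using hi)
    have hπc : (σb⁻¹ * σc) (πC⁻¹ i) = i := by rw [← hπC _ hci]; simp
    rw [Equiv.Perm.mul_apply, Equiv.Perm.inv_eq_iff_eq] at hπc
    exact hπc
  have rc1_out : ∀ i ∉ C, rc.1 i = σc i := by
    intro i hi
    show σc (πC⁻¹ i) = σc i
    have : πC⁻¹ i = i := by rw [Equiv.Perm.inv_eq_iff_eq]; exact (hπC' i hi).symm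
    rw [this]
  have rb2_in : ∀ i ∈ C, rb.2 i = lc i := fun i hi => by simp [hrb, hi]
  have rb2_out : ∀ i ∉ C, rb.2 i = lb i := fun i hi => by simp [hrb, hi]
  have rc2_in : ∀ i ∈ C, rc.2 i = lb i := fun i hi => by simp [hrc, hi]
  have rc2_out : ∀ i ∉ C, rc.2 i = lc i := fun i hi => by simp [hrc, hi]
  -- presence of the exchanged terms (their entries are entries of `pb` or `pc`)
  have presb := TropicalCensus.present_of_termSign_ne_zero ε (σb, lb) hb.1
  have presc := TropicalCensus.present_of_termSign_ne_zero ε (σc, lc) hc.1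
  have pres_rb : termSign ε rb ≠ 0 := by
    unfold termSign
    refine mul_ne_zero (by exact_mod_cast (Equiv.Perm.sign rb.1).ne_zero) (Finset.prod_ne_zero_iff.mpr fun i _ => ?_)
    by_cases hi : i ∈ C
    · rw [rb1_in i hi, rb2_in i hi]; exact presc i
    · rw [rb1_out i hi, rb2_out i hi]; exact presb i
  have pres_rc : termSign ε rc ≠ 0 := by
    unfold termSign
    refine mul_ne_zero (by exact_mod_cast (Equiv.Perm.sign rc.1).ne_zero) (Finset.prod_ne_zero_iff.mpr fun i _ => ?_)
    by_cases hi : i ∈ C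
    · rw [rc1_in i hi, rc2_in i hi]; exact presb i
    · rw [rc1_out i hi, rc2_out i hi]; exact presc i
  -- columnwise splitting of slopes and valuations
  have split : ∀ (f : Fin m → ℤ), ∑ i, f i = ∑ i ∈ C, f i + ∑ i ∈ Cᶜ, f i :=
    fun f => (Finset.sum_add_sum_compl C f).symm
  have s_rb : TropicalCensus.slope d rb = ∑ i ∈ C, (d (lc i) : ℤ) + ∑ i ∈ Cᶜ, (d (lb i) : ℤ) := by
    unfold TropicalCensus.slope; rw [split]
    congr 1
    · exact Finset.sum_congr rfl fun i hi => by rw [rb2_in i hi]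
    · exact Finset.sum_congr rfl fun i hi => by rw [rb2_out i (Finset.mem_compl.mp hi)]
  have s_rc : TropicalCensus.slope d rc = ∑ i ∈ C, (d (lb i) : ℤ) + ∑ i ∈ Cᶜ, (d (lc i) : ℤ) := by
    unfold TropicalCensus.slope; rw [split]
    congr 1
    · exact Finset.sum_congr rfl fun i hi => by rw [rc2_in i hi]
    · exact Finset.sum_congr rfl fun i hi => by rw [rc2_out i (Finset.mem_compl.mp hi)]
  have s_b : TropicalCensus.slope d (σb, lb) = ∑ i ∈ C, (d (lb i) : ℤ) + ∑ i ∈ Cᶜ, (d (lb i) : ℤ) := by unfold TropicalCensus.slope; rw [split]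
  have s_c : TropicalCensus.slope d (σc, lc) = ∑ i ∈ C, (d (lc i) : ℤ) + ∑ i ∈ Cᶜ, (d (lc i) : ℤ) := by unfold TropicalCensus.slope; rw [split]
  have v_rb : ∑ i, v (rb.1 i) i (rb.2 i) = ∑ i ∈ C, v (σc i) i (lc i) + ∑ i ∈ Cᶜ, v (σb i) i (lb i) := by
    rw [split]
    congr 1
    · exact Finset.sum_congr rfl fun i hi => by rw [rb1_in i hi, rb2_in i hi]
    · exact Finset.sum_congr rfl fun i hi => by
        rw [rb1_out i (Finset.mem_compl.mp hi), rb2_out i (Finset.mem_compl.mp hi)]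
  have v_rc : ∑ i, v (rc.1 i) i (rc.2 i) = ∑ i ∈ C, v (σb i) i (lb i) + ∑ i ∈ Cᶜ, v (σc i) i (lc i) := by
    rw [split]
    congr 1
    · exact Finset.sum_congr rfl fun i hi => by rw [rc1_in i hi, rc2_in i hi]
    · exact Finset.sum_congr rfl fun i hi => by
        rw [rc1_out i (Finset.mem_compl.mp hi), rc2_out i (Finset.mem_compl.mp hi)]
  have v_b : ∑ i, v (σb i) i (lb i) = ∑ i ∈ C, v (σb i) i (lb i) + ∑ i ∈ Cᶜ, v (σb i) i (lb i) := by rw [split]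
  have v_c : ∑ i, v (σc i) i (lc i) = ∑ i ∈ C, v (σc i) i (lc i) + ∑ i ∈ Cᶜ, v (σc i) i (lc i) := by rw [split]
  -- the four dominance inequalities
  have hne_ab : pa ≠ (σb, lb) := fun h => by rw [h] at hab; exact lt_irrefl _ hab
  have h1 : tropWeight d v θa rb ≤ tropWeight d v θa pa := by
    by_cases h : rb = pa
    · rw [h]
    · exact le_of_lt (ha.2 rb h pres_rb)
  have h2 : tropWeight d v θb pa < tropWeight d v θb (σb, lb) := hb.2 pa hne_ab ha.1
  have h3 : tropWeight d v θc pe ≤ tropWeight d v θc (σc, lc) := by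
    by_cases h : pe = (σc, lc)
    · rw [h]
    · exact le_of_lt (hc.2 pe h he.1)
  have h4 : tropWeight d v θe rc ≤ tropWeight d v θe pe := by
    by_cases h : rc = pe
    · rw [h]
    · exact le_of_lt (he.2 rc h pres_rc)
  simp only [tropWeight_eq] at h1 h2 h3 h4
  rw [s_rb, v_rb] at h1
  rw [s_rc, v_rc] at h4
  rw [s_b, v_b] at h2
  rw [s_c, v_c] at h3
  rw [s_b] at hab hCa
  rw [s_c] at hCe
  have hspa : TropicalCensus.slope d pa = ∑ i ∈ C, (d (lc i) : ℤ) + ∑ i ∈ Cᶜ, (d (lb i) : ℤ) := by linarith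
  have hspe : TropicalCensus.slope d pe = ∑ i ∈ C, (d (lb i) : ℤ) + ∑ i ∈ Cᶜ, (d (lc i) : ℤ) := by linarith
  rw [hspa] at h1 h2 hab
  rw [hspe] at h3 h4
  have key : 0 ≤ (θc - θb) * (∑ i ∈ C, (d (lb i) : ℤ) - ∑ i ∈ C, (d (lc i) : ℤ)) :=
    mul_nonneg (sub_nonneg.mpr hbc) (by linarith)
  nlinarith [key]

/-- **ENTANGLEMENT** (column form of the transfer law).  `p_a, p_b, p_c, p_e` dominant at `θ_a, θ_b ≤ θ_c, θ_e`; `p_b` and `p_c`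
carry the same exponent in every column other than `u, v`; the exponent surplus of `p_b` over `p_c` at the column `u` equals
`slope p_b − slope p_a = slope p_e − slope p_c`, and `slope p_a < slope p_b`.  Then `u` and `v` lie on ONE cycle of the quotient
`σ_b⁻¹ σ_c` (otherwise the cycle of `u` is an invariant column set with exactly that surplus, and `no_transfer` applies).  For a marked-edge
BINARY COUNTER (`slope p_t = t`, indices `a, b, c, e = w, w+2^u, w+2^v, w+2^u+2^v`) this says: the optimal covers of the patterns `w+2^u`
and `w+2^v` are entangled in EVERY context `w` — the marked loops of `u` and `v` lie on a common alternating cycle. -/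
theorem sameCycle_of_columns (d : Fin K → ℕ) (v ε : Fin m → Fin m → Fin K → ℤ) {θa θb θc θe : ℤ} (hbc : θb ≤ θc)
    {pa pb pc pe : Equiv.Perm (Fin m) × (Fin m → Fin K)}
    (ha : IsDominant d v ε θa pa) (hb : IsDominant d v ε θb pb) (hc : IsDominant d v ε θc pc) (he : IsDominant d v ε θe pe)
    (hab : TropicalCensus.slope d pa < TropicalCensus.slope d pb) {u w : Fin m}
    (hoff : ∀ i, i ≠ u → i ≠ w → d (pb.2 i) = d (pc.2 i))
    (hu : (d (pb.2 u) : ℤ) - d (pc.2 u) = TropicalCensus.slope d pb - TropicalCensus.slope d pa)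
    (he' : TropicalCensus.slope d pb - TropicalCensus.slope d pa = TropicalCensus.slope d pe - TropicalCensus.slope d pc) :
    (pb.1⁻¹ * pc.1).SameCycle u w := by
  classical
  by_contra hnot
  set π := pb.1⁻¹ * pc.1 with hπ
  let C : Finset (Fin m) := Finset.univ.filter fun i => π.SameCycle u i
  have hC : ∀ i, π i ∈ C ↔ i ∈ C := by
    intro i
    simp only [C, Finset.mem_filter, Finset.mem_univ, true_and]
    exact Equiv.Perm.sameCycle_apply_right
  have huC : u ∈ C := Finset.mem_filter.mpr ⟨Finset.mem_univ _, Equiv.Perm.SameCycle.refl _ _⟩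
  have hwC : w ∉ C := fun h => hnot (Finset.mem_filter.mp h).2
  -- on `C` the exponents of `pb`, `pc` agree except at `u`
  have hz : ∑ i ∈ C.erase u, ((d (pb.2 i) : ℤ) - d (pc.2 i)) = 0 := by
    refine Finset.sum_eq_zero fun i hi => ?_
    have hiu : i ≠ u := Finset.ne_of_mem_erase hi
    have hiw : i ≠ w := fun h => hwC (h ▸ Finset.mem_of_mem_erase hi)
    rw [hoff i hiu hiw, sub_self]
  have hsum : ∑ i ∈ C, (d (pb.2 i) : ℤ) - ∑ i ∈ C, (d (pc.2 i) : ℤ) = (d (pb.2 u) : ℤ) - d (pc.2 u) := by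
    rw [← Finset.sum_sub_distrib, ← Finset.add_sum_erase C _ huC, hz, add_zero]
  exact no_transfer d v ε hbc ha hb hc he hab C hC (by rw [hsum, hu]) (by rw [hsum, hu, he'])

end TransferLaw

/-! ## §2 The unit-step law -/

namespace UnitStep

variable {m K : ℕ}

/-- On an invariant column set the exponent mass never drops along the chain (it rises strictly where the terms differ,
`sum_d_lt_of_isDominant_invariant`, and is unchanged where they agree). -/
theorem sum_d_le_of_invariant (d : Fin K → ℕ) (v ε : Fin m → Fin m → Fin K → ℤ) {θ₁ θ₂ : ℤ} (hθ : θ₁ < θ₂)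
    {σ₁ σ₂ : Equiv.Perm (Fin m)} {l₁ l₂ : Fin m → Fin K}
    (h₁ : IsDominant d v ε θ₁ (σ₁, l₁)) (h₂ : IsDominant d v ε θ₂ (σ₂, l₂)) (T : Finset (Fin m))
    (hT : ∀ b, (σ₁⁻¹ * σ₂) b ∈ T ↔ b ∈ T) :
    ∑ b ∈ T, (d (l₁ b) : ℤ) ≤ ∑ b ∈ T, (d (l₂ b) : ℤ) := by
  by_cases hne : ∃ b ∈ T, σ₁ b ≠ σ₂ b ∨ l₁ b ≠ l₂ b
  · exact (sum_d_lt_of_isDominant_invariant d v ε hθ h₁ h₂ T hT hne).le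
  · push Not at hne
    exact le_of_eq (Finset.sum_congr rfl fun b hb => by rw [(hne b hb).2])

/-- **UNIT-STEP LAW (no split).**  If two dominant terms (earlier `θ₁ < θ₂` later) have slopes differing by at most one, then no
invariant column set `T` of the quotient `σ₁⁻¹ σ₂` sees differences both on `T` and off `T` (each side would raise the integer
exponent mass by at least one, `sum_d_lt_of_isDominant_split`). -/
theorem not_split (d : Fin K → ℕ) (v ε : Fin m → Fin m → Fin K → ℤ) {θ₁ θ₂ : ℤ} (hθ : θ₁ < θ₂)
    {σ₁ σ₂ : Equiv.Perm (Fin m)} {l₁ l₂ : Fin m → Fin K}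
    (h₁ : IsDominant d v ε θ₁ (σ₁, l₁)) (h₂ : IsDominant d v ε θ₂ (σ₂, l₂))
    (hgap : TropicalCensus.slope d (σ₂, l₂) ≤ TropicalCensus.slope d (σ₁, l₁) + 1) (T : Finset (Fin m))
    (hT : ∀ b, (σ₁⁻¹ * σ₂) b ∈ T ↔ b ∈ T) (hin : ∃ b ∈ T, σ₁ b ≠ σ₂ b ∨ l₁ b ≠ l₂ b)
    (hout : ∃ b ∉ T, σ₁ b ≠ σ₂ b ∨ l₁ b ≠ l₂ b) : False := by
  obtain ⟨hA, hB⟩ := sum_d_lt_of_isDominant_split d v ε hθ h₁ h₂ T hT hin hout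
  have e₁ : (∑ b ∈ T, (d (l₁ b) : ℤ)) + ∑ b ∈ Tᶜ, (d (l₁ b) : ℤ) = TropicalCensus.slope d (σ₁, l₁) := Finset.sum_add_sum_compl T _
  have e₂ : (∑ b ∈ T, (d (l₂ b) : ℤ)) + ∑ b ∈ Tᶜ, (d (l₂ b) : ℤ) = TropicalCensus.slope d (σ₂, l₂) := Finset.sum_add_sum_compl T _
  omega

/-- **UNIT-STEP LAW (single cycle).**  With slope gap at most one, all columns where the two terms differ (in row or class) lie on ONE
cycle of the quotient `σ₁⁻¹ σ₂`.  For a marked-edge binary counter (consecutive slopes `t, t+1`): consecutive optimal covers differ by a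
single alternating cycle, which passes through the marked loops of the bits `0, …, j` flipped at that step. -/
theorem sameCycle (d : Fin K → ℕ) (v ε : Fin m → Fin m → Fin K → ℤ) {θ₁ θ₂ : ℤ} (hθ : θ₁ < θ₂)
    {σ₁ σ₂ : Equiv.Perm (Fin m)} {l₁ l₂ : Fin m → Fin K}
    (h₁ : IsDominant d v ε θ₁ (σ₁, l₁)) (h₂ : IsDominant d v ε θ₂ (σ₂, l₂))
    (hgap : TropicalCensus.slope d (σ₂, l₂) ≤ TropicalCensus.slope d (σ₁, l₁) + 1) {b b' : Fin m}
    (hb : σ₁ b ≠ σ₂ b ∨ l₁ b ≠ l₂ b) (hb' : σ₁ b' ≠ σ₂ b' ∨ l₁ b' ≠ l₂ b') :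
    (σ₁⁻¹ * σ₂).SameCycle b b' := by
  classical
  by_contra hnot
  set π := σ₁⁻¹ * σ₂ with hπ
  let T : Finset (Fin m) := Finset.univ.filter fun c => π.SameCycle b c
  have hT : ∀ c, π c ∈ T ↔ c ∈ T := by
    intro c
    simp only [T, Finset.mem_filter, Finset.mem_univ, true_and]
    exact Equiv.Perm.sameCycle_apply_right
  exact not_split d v ε hθ h₁ h₂ hgap T hT
    ⟨b, Finset.mem_filter.mpr ⟨Finset.mem_univ _, Equiv.Perm.SameCycle.refl _ _⟩, hb⟩
    ⟨b', fun h => hnot (Finset.mem_filter.mp h).2, hb'⟩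

/-- **UNIT-STEP LAW (pure relabel).**  With slope gap at most one, if the two terms differ at a column `b` which the quotient fixes
(`σ₁ b = σ₂ b`, so only the class changes there), then `b` is the ONLY column where they differ. -/
theorem eq_of_apply_eq (d : Fin K → ℕ) (v ε : Fin m → Fin m → Fin K → ℤ) {θ₁ θ₂ : ℤ} (hθ : θ₁ < θ₂)
    {σ₁ σ₂ : Equiv.Perm (Fin m)} {l₁ l₂ : Fin m → Fin K}
    (h₁ : IsDominant d v ε θ₁ (σ₁, l₁)) (h₂ : IsDominant d v ε θ₂ (σ₂, l₂))
    (hgap : TropicalCensus.slope d (σ₂, l₂) ≤ TropicalCensus.slope d (σ₁, l₁) + 1) {b b' : Fin m} (hfix : σ₁ b = σ₂ b)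
    (hb : l₁ b ≠ l₂ b) (hb' : σ₁ b' ≠ σ₂ b' ∨ l₁ b' ≠ l₂ b') : b' = b := by
  have hsc := sameCycle d v ε hθ h₁ h₂ hgap (Or.inr hb) hb'
  have hfixπ : (σ₁⁻¹ * σ₂) b = b := by
    rw [Equiv.Perm.mul_apply, Equiv.Perm.inv_eq_iff_eq]; exact hfix.symm
  obtain ⟨i, hi⟩ := hsc
  rw [Equiv.Perm.zpow_apply_eq_self_of_apply_eq_self hfixπ] at hi
  exact hi.symm

end UnitStep

/-! ## §3 Equally spaced slopes: strictly convex valuation sums -/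

namespace EqualSteps

variable {m K : ℕ}

/-- **CONVEX VALUATIONS.**  If `p₁` is dominant at `θ`, `p₀ ≠ p₁` and `p₂` are present terms and the slope steps are equal
(`slope p₁ − slope p₀ = slope p₂ − slope p₁`), then the valuation sums make a strictly convex triple:
`V p₁ − V p₀ < V p₂ − V p₁` (indeed `V p₁ − V p₀ < θ·g ≤ V p₂ − V p₁`, `g` the common step).  Along a dominant chain with equally spaced
slopes the valuation sums are therefore strictly convex in the index; for a marked-edge binary counter this is strict convexity of the
pattern cost in the binary value, whence (equal-width chords) its strict supermodularity on the lattice of OFF-sets. [folklore] -/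
theorem valuation_step_lt (d : Fin K → ℕ) (v ε : Fin m → Fin m → Fin K → ℤ) {θ : ℤ}
    {p₀ p₁ p₂ : Equiv.Perm (Fin m) × (Fin m → Fin K)} (h₁ : IsDominant d v ε θ p₁)
    (h₀ : termSign ε p₀ ≠ 0) (h₂ : termSign ε p₂ ≠ 0) (hne : p₀ ≠ p₁)
    (hstep : TropicalCensus.slope d p₁ - TropicalCensus.slope d p₀ = TropicalCensus.slope d p₂ - TropicalCensus.slope d p₁) :
    ∑ i, v (p₁.1 i) i (p₁.2 i) - ∑ i, v (p₀.1 i) i (p₀.2 i) <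
      ∑ i, v (p₂.1 i) i (p₂.2 i) - ∑ i, v (p₁.1 i) i (p₁.2 i) := by
  have a := h₁.2 p₀ hne h₀
  have b : tropWeight d v θ p₂ ≤ tropWeight d v θ p₁ := by
    by_cases h : p₂ = p₁
    · rw [h]
    · exact le_of_lt (h₁.2 p₂ h h₂)
  simp only [TransferLaw.tropWeight_eq] at a b
  have h3 : θ * (TropicalCensus.slope d p₁ - TropicalCensus.slope d p₀) =
      θ * (TropicalCensus.slope d p₂ - TropicalCensus.slope d p₁) := by rw [hstep]
  linarith [h3]

end EqualSteps

end Summit.ValiantsHypothesis.ValiantsHypothesis.Theorems.KPlusLogSqLaw
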